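import Mathlib.Combinatorics.Enumerative.DoubleCounting
import Mathlib.Algebra.Order.BigOperators.Group.Finset
import Literature.Computability.Complexity.ProofComplexity
import Literature.Computability.MetaComplexity.ResolutionProofs
import HarnessLib

/-!
# Haken's theorem: resolution refutations of the pigeonhole principle are exponentially long

Sibling proof file of `ProofComplexity.lean` (D-0014 append protocol: the statements file is
unchanged). It discharges the named fact `Literature.Computability.Complexity.haken_pigeonhole`
(**pnp.S31**; Haken 1985, §2.1, Theorem, p. 301: "There exists a constant `c`, `c > 1`, so
that, for sufficiently large `n`, every resolution proof of `PF_n` contains at least `c^n`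
different clauses") as `haken_pigeonhole_holds : haken_pigeonhole`, i.e. in the vendored
all-`n` form `∃ c > 1, ∀ n π, IsResRefutation (pigeonholeCNF (n+1) n) π → c ^ n ≤ π.length`
(we obtain `c = 101/100`; Haken's constant is `1.49^{0.01}` for `n > 200`, p. 305).

The proof formalised here is not Haken's bottleneck counting but the simplified argument of
Beame–Pitassi (FOCS 1996, §3, Lemma 1 and Theorem 2: "For sufficiently large `n`, any
Resolution proof of `¬PHP^n_{n-1}` requires size `2^{n/20}`", pp. 276–277), in the
presentation of Jukna, *Extremal Combinatorics* (2nd ed., 2011), §4.8.2, Thm. 4.13 with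
Claims 4.14–4.15, with one change of bookkeeping: the restrictions `x_{ij} := 1` of the greedy
phase are not applied to the refutation syntactically (which would require re-indexing it into
a refutation of `PHP^{n}_{n-1}`); instead every notion (critical assignments, semantic
implication, monotone variables) is taken *relative to a partial matching* `ρ`, and a greedy
step shrinks the class of critical assignments. The width lemma and the averaging step are
then proved once, uniformly in `ρ`, for the original refutation.

## Proof architecture (Jukna 2011, proof of Thm. 4.13; everything relative to `ρ`)

* `HakenPHP.assign`, `HakenPHP.IsPM`, `HakenPHP.Crit`: placements of pigeons
  `f : ℕ → Option ℕ`, their truth assignments on the variables `x_{ij} = i * n + j` of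
  `pigeonholeCNF (n + 1) n`, partial matchings `ρ : Finset (ℕ × ℕ)`, and the critical
  placements compatible with `ρ` (extending `ρ`, injective, exactly one pigeon `≤ n`
  unplaced). `HakenPHP.exists_crit_none`: for every free pigeon there is a compatible
  critical placement omitting exactly it (the other free pigeons are matched with the free
  holes, of which there are equally many).
* `HakenPHP.Imp n ρ S C` (Jukna's "witnesses", Beame–Pitassi's "complexity"): every
  compatible critical placement placing the pigeons of `S` satisfies `C`. Initial clauses are
  implied by `≤ 1` free pigeon clause (`exists_imp_initial`), the empty clause only by all `u`
  free pigeon clauses (`freeP_subset_of_imp_empty`), resolvents are subadditive and weakenings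
  monotone (soundness of the rules, `ResolutionProofs.lean`); hence `exists_medium_clause`:
  the first line not implied by `≤ u/3` free pigeon clauses has a minimal implying set `S`
  with `u/3 < |S| ≤ 2u/3` (needs `u ≥ 3`).
* `HakenPHP.monoVars n ρ C`: the variables of Buss's positive translation `C⁺` (Claim 4.14)
  among free pigeons and holes; the width lemma `card_monoVars_ge` (Claim 4.15, Beame–Pitassi
  Lemma 1): a clause with a minimal implying set `S` has `≥ |S| (u - |S|)` monotone variables
  (move the hole of a free pigeon `k ∉ S` to the omitted pigeon `i ∈ S`; the two critical
  assignments differ exactly on `x_{il}`, `x_{kl}`).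
* `HakenPHP.greedy_step`, `HakenPHP.greedy` (the restriction phase of Thm. 4.13 /
  Beame–Pitassi Thm. 2): by double counting over the `≤ (n+1) n` free pairs, some pair
  `(i, j)` is a monotone variable of at least a `T / ((n+1) n)` fraction of the clauses that
  are *alive* (falsified by some compatible critical placement) and *long* (`≥ T` monotone
  variables); after adding `(i, j)` to `ρ` these clauses are satisfied by every compatible
  critical placement (`imp_empty_insert`), so `t ≤ n` greedy steps leave at most
  `(1 - T/((n+1) n))^t · |π|` long alive clauses (`HakenPHP.bad`).
* `HakenPHP.main_counting`: for `n ≥ 13`, `d = ⌊n/5⌋`, `T = ⌊n²/8⌋`, `u = n + 1 - d`: the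
  medium clause relative to the greedy `ρ_d` is alive and has `≥ 2u²/9 ≥ T` monotone
  variables, so one long alive clause survives: `((n+1)n)^d ≤ ((n+1)n - T)^d |π|`, and
  `(n+1) n ≤ 9 T` gives `9^d ≤ 8^d |π|`. Finally `haken_pigeonhole_holds`: for `n ≥ 13`,
  `(101/100)^n ≤ (101/100)^{9d} ≤ (9/8)^d ≤ |π|`; for `1 ≤ n ≤ 12`, `(101/100)^n < 2 ≤ |π|`
  (`two_le_length`: no clause of `PHP^{n+1}_n` is empty, so the empty clause has a premise);
  for `n = 0`, `1 ≤ |π|`.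

## References

* A. Haken, *The intractability of resolution*, Theoret. Comput. Sci. 39 (1985) 297–308:
  §2.1, Theorem (p. 301); end of §2 (p. 305: `c = 1.49^{0.01}` for `n > 200`).
* P. Beame, T. Pitassi, *Simplified and improved resolution lower bounds*, Proc. 37th FOCS
  (1996) 274–282: §3, Lemma 1 and Theorem 2 (pp. 276–277), critical assignments and the
  monotone translation (p. 276).
* S. Jukna, *Extremal Combinatorics, with applications in computer science*, 2nd ed.,
  Springer 2011: §4.8.2, Theorem 4.13, Claims 4.14 and 4.15 (pp. 48–51).
* S. Buss, *Polynomial size proofs of the propositional pigeonhole principle*, J. Symbolic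
  Logic 52 (1987) 916–927 (the positive translation `C ↦ C⁺`, as credited by Jukna).
-/

namespace Literature.Computability.Complexity

open _root_.Computability MetaComplexity Finset

namespace HakenPHP

/-! ### Placements of pigeons, critical assignments, partial matchings -/

/-- The truth assignment of a placement `f` (pigeon `i ↦` hole `f i`, `none` = unplaced) on the
variables `x_{ij} = i * n + j` of `PHP^{n+1}_n`: `x_v` is true iff pigeon `v / n` sits in hole
`v % n`. [Jukna 2011, §4.8.2 (critical truth assignments); Beame–Pitassi 1996, §3] [folklore] -/
def assign (n : ℕ) (f : ℕ → Option ℕ) : ℕ → Bool :=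
  fun v => decide (f (v / n) = some (v % n))

/-- A partial matching `ρ` of pigeons `≤ n` to holes `< n` (a set of pairs, injective in both
coordinates): the restrictions of the Beame–Pitassi argument, kept as data rather than applied
syntactically. [Beame–Pitassi 1996, §3; Jukna 2011, proof of Thm. 4.13] [folklore] -/
structure IsPM (n : ℕ) (ρ : Finset (ℕ × ℕ)) : Prop where
  /-- matched pigeons are `≤ n` -/
  fst_le : ∀ p ∈ ρ, p.1 ≤ n
  /-- matched holes are `< n` -/
  snd_lt : ∀ p ∈ ρ, p.2 < n
  /-- no pigeon is matched twice -/
  inj_fst : ∀ p ∈ ρ, ∀ q ∈ ρ, p.1 = q.1 → p = q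
  /-- no hole is matched twice -/
  inj_snd : ∀ p ∈ ρ, ∀ q ∈ ρ, p.2 = q.2 → p = q

/-- The pigeons `≤ n` not matched by `ρ`. [folklore] -/
def freeP (n : ℕ) (ρ : Finset (ℕ × ℕ)) : Finset ℕ :=
  range (n + 1) \ ρ.image Prod.fst

/-- The holes `< n` not matched by `ρ`. [folklore] -/
def freeH (n : ℕ) (ρ : Finset (ℕ × ℕ)) : Finset ℕ :=
  range n \ ρ.image Prod.snd

/-- A *critical* placement compatible with the partial matching `ρ`: it extends `ρ`, places
pigeons `≤ n` into holes `< n` injectively, and leaves exactly one pigeon `≤ n` unplaced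
(pigeons `> n` are never placed). [Jukna 2011, §4.8.2 (`i`-critical truth assignments);
Beame–Pitassi 1996, §3] [folklore] -/
structure Crit (n : ℕ) (ρ : Finset (ℕ × ℕ)) (f : ℕ → Option ℕ) : Prop where
  /-- `f` extends the partial matching `ρ` -/
  ext : ∀ p ∈ ρ, f p.1 = some p.2
  /-- only pigeons `≤ n` are placed -/
  le_of_some : ∀ i j, f i = some j → i ≤ n
  /-- pigeons are placed in holes `< n` -/
  lt_of_some : ∀ i j, f i = some j → j < n
  /-- no two pigeons share a hole -/
  inj : ∀ i i' j, f i = some j → f i' = some j → i = i'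
  /-- at most one pigeon `≤ n` is unplaced -/
  uniq : ∀ i i', i ≤ n → i' ≤ n → f i = none → f i' = none → i = i'
  /-- some pigeon `≤ n` is unplaced -/
  exists_none : ∃ i ≤ n, f i = none

/-- Semantic implication over critical placements compatible with `ρ`: every such placement
that places all pigeons of `S` satisfies the clause `C` (Beame–Pitassi's "the pigeon clauses
of `S` imply `C` on critical assignments"). [Jukna 2011, proof of Claim 4.15 (witnesses);
Beame–Pitassi 1996, §3] [folklore] -/
def Imp (n : ℕ) (ρ : Finset (ℕ × ℕ)) (S : Finset ℕ) (C : Finset (Literal ℕ)) : Prop :=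
  ∀ f, Crit n ρ f → (∀ k ∈ S, f k ≠ none) → finsetClauseEval (assign n f) C

variable {n : ℕ}

/-- Value of the variable `x_{ij}` under a placement. [folklore] -/
theorem assign_var (hn : 0 < n) (f : ℕ → Option ℕ) (i : ℕ) {j : ℕ} (hj : j < n) :
    assign n f (i * n + j) = decide (f i = some j) := by
  unfold assign
  rw [Nat.add_comm, Nat.add_mul_div_right _ _ hn, Nat.add_mul_mod_self_right,
    Nat.div_eq_of_lt hj, Nat.mod_eq_of_lt hj, Nat.zero_add]

/-- A set-clause is satisfied iff one of its literals `(v, b)` has `σ v = b`. [folklore] -/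
theorem finsetClauseEval_iff (σ : ℕ → Bool) (C : Finset (Literal ℕ)) :
    finsetClauseEval σ C ↔ ∃ l ∈ C, σ l.1 = l.2 := by
  simp [finsetClauseEval, Literal.eval]

/-- Membership in `freeP`. [folklore] -/
theorem mem_freeP {ρ : Finset (ℕ × ℕ)} {i : ℕ} :
    i ∈ freeP n ρ ↔ i ≤ n ∧ ∀ p ∈ ρ, p.1 ≠ i := by
  simp only [freeP, mem_sdiff, mem_range, Nat.lt_succ_iff, mem_image, not_exists,
    ne_eq, Prod.forall, Prod.exists, exists_and_right, exists_eq_right]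
  exact ⟨fun ⟨h1, h2⟩ => ⟨h1, fun a b hab => fun e => h2 b (e ▸ hab)⟩,
    fun ⟨h1, h2⟩ => ⟨h1, fun b hb => h2 i b hb rfl⟩⟩

/-- Membership in `freeH`. [folklore] -/
theorem mem_freeH {ρ : Finset (ℕ × ℕ)} {j : ℕ} :
    j ∈ freeH n ρ ↔ j < n ∧ ∀ p ∈ ρ, p.2 ≠ j := by
  simp only [freeH, mem_sdiff, mem_range, mem_image, not_exists, ne_eq, Prod.forall,
    Prod.exists, exists_eq_right]
  exact ⟨fun ⟨h1, h2⟩ => ⟨h1, fun a b hab => fun e => h2 a (e ▸ hab)⟩,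
    fun ⟨h1, h2⟩ => ⟨h1, fun a ha => h2 a j ha rfl⟩⟩

/-- `freeP` has `n + 1 - |ρ|` elements. [folklore] -/
theorem card_freeP {ρ : Finset (ℕ × ℕ)} (hρ : IsPM n ρ) :
    (freeP n ρ).card = n + 1 - ρ.card := by
  unfold freeP
  have hsub : ρ.image Prod.fst ⊆ range (n + 1) := by
    intro i hi
    obtain ⟨p, hp, rfl⟩ := mem_image.1 hi
    exact mem_range.2 (Nat.lt_succ_of_le (hρ.fst_le p hp))
  rw [card_sdiff, inter_eq_left.2 hsub, card_range,
    card_image_of_injOn fun p hp q hq h => hρ.inj_fst p hp q hq h]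

/-- `freeH` has `n - |ρ|` elements. [folklore] -/
theorem card_freeH {ρ : Finset (ℕ × ℕ)} (hρ : IsPM n ρ) :
    (freeH n ρ).card = n - ρ.card := by
  unfold freeH
  have hsub : ρ.image Prod.snd ⊆ range n := by
    intro j hj
    obtain ⟨p, hp, rfl⟩ := mem_image.1 hj
    exact mem_range.2 (hρ.snd_lt p hp)
  rw [card_sdiff, inter_eq_left.2 hsub, card_range,
    card_image_of_injOn fun p hp q hq h => hρ.inj_snd p hp q hq h]

/-- A matched pigeon is placed in its `ρ`-hole by every compatible placement; a free pigeon
is not a first coordinate of `ρ`. [folklore] -/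
theorem not_mem_freeP_iff {ρ : Finset (ℕ × ℕ)} {i : ℕ} (hi : i ≤ n) :
    i ∉ freeP n ρ ↔ ∃ p ∈ ρ, p.1 = i := by
  rw [mem_freeP]
  push Not
  simp [hi]

/-! ### The initial clauses are implied by at most one pigeon clause -/

/-- A placement placing pigeon `i` satisfies the pigeon clause of `i`. [Jukna 2011, proof of
Claim 4.15] [folklore] -/
theorem eval_pigeonClause (hn : 0 < n) {f : ℕ → Option ℕ} (hf : ∀ i j, f i = some j → j < n)
    {i : ℕ} (hi : f i ≠ none) :
    finsetClauseEval (assign n f) ((List.range n).map fun j => (i * n + j, true)).toFinset := by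
  obtain ⟨j, hj⟩ := Option.ne_none_iff_exists'.1 hi
  rw [finsetClauseEval_iff]
  refine ⟨(i * n + j, true), ?_, ?_⟩
  · rw [List.mem_toFinset, List.mem_map]
    exact ⟨j, List.mem_range.2 (hf i j hj), rfl⟩
  · simp only [assign_var hn f i (hf i j hj), hj, decide_true]

/-- Every critical placement satisfies the hole clauses. [Jukna 2011, proof of Claim 4.15
("all other clauses are satisfied by every critical assignment")] [folklore] -/
theorem eval_holeClause (hn : 0 < n) {ρ : Finset (ℕ × ℕ)} {f : ℕ → Option ℕ} (hf : Crit n ρ f)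
    {i i' j : ℕ} (hii' : i ≠ i') (hj : j < n) :
    finsetClauseEval (assign n f) [(i * n + j, false), (i' * n + j, false)].toFinset := by
  rw [finsetClauseEval_iff]
  by_cases h : f i = some j
  · refine ⟨(i' * n + j, false), by simp, ?_⟩
    have h' : f i' ≠ some j := fun h' => hii' (hf.inj i i' j h h')
    simp only [assign_var hn f i' hj, h', decide_false]
  · refine ⟨(i * n + j, false), by simp, ?_⟩
    simp only [assign_var hn f i hj, h, decide_false]

/-- Initial clauses of `PHP^{n+1}_n` are implied by at most one free pigeon clause.
[Jukna 2011, proof of Claim 4.15 ("the weight of these initial pigeon clauses is 1")]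
[folklore] -/
theorem exists_imp_initial (hn : 0 < n) {ρ : Finset (ℕ × ℕ)} {C : Finset (Literal ℕ)}
    (hC : C ∈ (pigeonholeCNF (n + 1) n).clauseFinsets) :
    ∃ S ⊆ freeP n ρ, S.card ≤ 1 ∧ Imp n ρ S C := by
  unfold CNF.clauseFinsets at hC
  obtain ⟨D, hD, rfl⟩ := List.mem_map.1 hC
  simp only [pigeonholeCNF, List.mem_append, List.mem_map, List.mem_flatMap,
    List.mem_range] at hD
  rcases hD with ⟨i, hi, rfl⟩ | ⟨j, hj, i', -, i, hii', rfl⟩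
  · -- pigeon clause of pigeon `i ≤ n`
    by_cases hiU : i ∈ freeP n ρ
    · refine ⟨{i}, by simpa using hiU, by simp, fun f hf hS => ?_⟩
      exact eval_pigeonClause hn hf.lt_of_some (hS i (mem_singleton_self i))
    · obtain ⟨p, hp, hpi⟩ := (not_mem_freeP_iff (Nat.lt_succ_iff.1 hi)).1 hiU
      refine ⟨∅, by simp, by simp, fun f hf _ => ?_⟩
      refine eval_pigeonClause hn hf.lt_of_some ?_
      rw [← hpi, hf.ext p hp]
      simp
  · -- hole clause for hole `j` and pigeons `i < i'`
    refine ⟨∅, by simp, by simp, fun f hf _ => ?_⟩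
    exact eval_holeClause hn hf hii'.ne hj

/-! ### Existence of critical placements omitting a given free pigeon -/

/-- For every free pigeon `i` there is a critical placement compatible with `ρ` omitting
exactly `i` (match the other free pigeons with the free holes, of which there are equally
many). [Jukna 2011, §4.8.2; Beame–Pitassi 1996, §3] [folklore] -/
theorem exists_crit_none {ρ : Finset (ℕ × ℕ)} (hρ : IsPM n ρ) {i : ℕ}
    (hi : i ∈ freeP n ρ) :
    ∃ f, Crit n ρ f ∧ f i = none ∧ ∀ k ≤ n, k ≠ i → f k ≠ none := by
  classical
  have hiU := hi
  rw [mem_freeP] at hi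
  obtain ⟨hin, hiρ⟩ := hi
  -- cardinalities: `|freeP \ {i}| = n - |ρ| = |freeH|`
  have hρn : ρ.card ≤ n := by
    have h1 : 0 < (freeP n ρ).card := card_pos.2 ⟨i, hiU⟩
    rw [card_freeP hρ] at h1
    omega
  set A := (freeP n ρ).erase i with hA
  set B := freeH n ρ with hB
  have hcard : A.card = B.card := by
    rw [hA, card_erase_of_mem hiU, card_freeP hρ, hB, card_freeH hρ]
    omega
  let e : A ≃ B := (equivFinOfCardEq hcard).trans (equivFinOfCardEq rfl).symm
  -- the placement: free pigeons other than `i` follow `e`, matched pigeons follow `ρ`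
  let f : ℕ → Option ℕ := fun k =>
    if hk : k ∈ A then some (e ⟨k, hk⟩ : ℕ)
    else if hk' : ∃ p ∈ ρ, p.1 = k then some (Classical.choose hk').2 else none
  have hfA : ∀ k (hk : k ∈ A), f k = some (e ⟨k, hk⟩ : ℕ) := fun k hk => by
    simp only [f, dif_pos hk]
  have hfρ : ∀ p ∈ ρ, f p.1 = some p.2 := by
    intro p hp
    have hk : p.1 ∉ A := by
      rw [hA, mem_erase, mem_freeP]
      exact fun h => h.2.2 p hp rfl
    have hk' : ∃ q ∈ ρ, q.1 = p.1 := ⟨p, hp, rfl⟩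
    have hq := Classical.choose_spec hk'
    have hqp : Classical.choose hk' = p := hρ.inj_fst _ hq.1 p hp hq.2
    simp only [f, dif_neg hk, dif_pos hk', hqp]
  have hfnone : ∀ k, k ∉ A → (∀ p ∈ ρ, p.1 ≠ k) → f k = none := by
    intro k hk hk'
    have : ¬ ∃ p ∈ ρ, p.1 = k := fun ⟨p, hp, hpk⟩ => hk' p hp hpk
    simp only [f, dif_neg hk, dif_neg this]
  -- values: either an `e`-value (in `freeH`) or a `ρ`-hole
  have hval : ∀ k j, f k = some j →
      (∃ hk : k ∈ A, (e ⟨k, hk⟩ : ℕ) = j) ∨ ∃ p ∈ ρ, p = (k, j) := by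
    intro k j hkj
    by_cases hk : k ∈ A
    · rw [hfA k hk] at hkj
      exact Or.inl ⟨hk, Option.some_injective _ hkj⟩
    · by_cases hk' : ∃ p ∈ ρ, p.1 = k
      · obtain ⟨p, hp, hpk⟩ := hk'
        rw [← hpk, hfρ p hp] at hkj
        refine Or.inr ⟨p, hp, ?_⟩
        rw [← hpk, ← Option.some_injective _ hkj]
      · rw [hfnone k hk (fun p hp hpk => hk' ⟨p, hp, hpk⟩)] at hkj
        exact absurd hkj (by simp)
  have hfi : f i = none := hfnone i (by simp [hA]) hiρ
  refine ⟨f, ⟨hfρ, ?_, ?_, ?_, ?_, ⟨i, hin, hfi⟩⟩, hfi, ?_⟩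
  · -- placed pigeons are `≤ n`
    intro k j hkj
    rcases hval k j hkj with ⟨hk, -⟩ | ⟨p, hp, rfl⟩
    · rw [hA, mem_erase, mem_freeP] at hk
      exact hk.2.1
    · exact hρ.fst_le _ hp
  · -- holes are `< n`
    intro k j hkj
    rcases hval k j hkj with ⟨hk, he⟩ | ⟨p, hp, rfl⟩
    · have := (e ⟨k, hk⟩).2
      rw [he, hB, mem_freeH] at this
      exact this.1
    · exact hρ.snd_lt _ hp
  · -- injectivity
    intro k k' j hkj hk'j
    rcases hval k j hkj with ⟨hk, he⟩ | ⟨p, hp, rfl⟩ <;>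
      rcases hval k' j hk'j with ⟨hk', he'⟩ | ⟨p', hp', hp'e⟩
    · have := e.injective (Subtype.ext (he.trans he'.symm))
      exact congrArg Subtype.val this
    · exfalso
      have hmem := (e ⟨k, hk⟩).2
      rw [he, hB, mem_freeH] at hmem
      exact hmem.2 p' hp' (by rw [hp'e])
    · exfalso
      have hmem := (e ⟨k', hk'⟩).2
      rw [he', hB, mem_freeH] at hmem
      exact hmem.2 _ hp rfl
    · have := hρ.inj_snd _ hp _ hp' (by rw [hp'e])
      rw [hp'e] at this
      exact (Prod.ext_iff.1 this).1
  · -- the only unplaced pigeon `≤ n` is `i`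
    have key : ∀ k ≤ n, f k = none → k = i := by
      intro k hk hknone
      by_contra hki
      by_cases hkA : k ∈ A
      · rw [hfA k hkA] at hknone
        exact absurd hknone (by simp)
      · have : ∃ p ∈ ρ, p.1 = k := by
          by_contra hno
          push Not at hno
          exact hkA (by rw [hA, mem_erase, mem_freeP]; exact ⟨hki, hk, hno⟩)
        obtain ⟨p, hp, hpk⟩ := this
        rw [← hpk, hfρ p hp] at hknone
        exact absurd hknone (by simp)
    intro k k' hk hk' hknone hk'none
    rw [key k hk hknone, key k' hk' hk'none]
  · -- every other pigeon `≤ n` is placed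
    intro k hk hki hknone
    by_cases hkA : k ∈ A
    · rw [hfA k hkA] at hknone
      exact absurd hknone (by simp)
    · have : ∃ p ∈ ρ, p.1 = k := by
        by_contra hno
        push Not at hno
        exact hkA (by rw [hA, mem_erase, mem_freeP]; exact ⟨hki, hk, hno⟩)
      obtain ⟨p, hp, hpk⟩ := this
      rw [← hpk, hfρ p hp] at hknone
      exact absurd hknone (by simp)

/-! ### Soundness of the rules for `Imp`; the medium-complexity clause -/

/-- `Imp` is monotone in the set of pigeon clauses. [folklore] -/
theorem Imp.mono {ρ : Finset (ℕ × ℕ)} {S T : Finset ℕ} {C : Finset (Literal ℕ)}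
    (h : Imp n ρ S C) (hST : S ⊆ T) : Imp n ρ T C :=
  fun f hf hT => h f hf fun k hk => hT k (hST hk)

/-- `Imp` is preserved by weakening. [Jukna 2011, §4.8.1 (soundness)] [folklore] -/
theorem Imp.weaken {ρ : Finset (ℕ × ℕ)} {S : Finset ℕ} {C D : Finset (Literal ℕ)}
    (h : Imp n ρ S C) (hCD : C ⊆ D) : Imp n ρ S D :=
  fun f hf hS => finsetClauseEval_of_subset (h f hf hS) hCD

/-- `Imp` is subadditive under resolution (soundness of the resolution rule on critical
placements). [Jukna 2011, §4.8.1 and proof of Claim 4.15 ("by soundness the weight of a clause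
is at most the sum of the weights of the two clauses from which it is derived")] [folklore] -/
theorem Imp.resolvent {ρ : Finset (ℕ × ℕ)} {S₁ S₂ : Finset ℕ} {C D E : Finset (Literal ℕ)}
    {v : ℕ} (h₁ : Imp n ρ S₁ C) (h₂ : Imp n ρ S₂ D) (hE : IsResolvent C D v E) :
    Imp n ρ (S₁ ∪ S₂) E :=
  fun f hf hS => finsetClauseEval_of_isResolvent hE
    (h₁ f hf fun k hk => hS k (mem_union_left _ hk))
    (h₂ f hf fun k hk => hS k (mem_union_right _ hk))

/-- Only the set of all free pigeons implies the empty clause ("the weight of the final clause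
is `m`"). [Jukna 2011, proof of Claim 4.15] [folklore] -/
theorem freeP_subset_of_imp_empty {ρ : Finset (ℕ × ℕ)} (hρ : IsPM n ρ) {S : Finset ℕ}
    (hS : S ⊆ freeP n ρ) (h : Imp n ρ S ∅) : freeP n ρ ⊆ S := by
  intro i hi
  by_contra hiS
  obtain ⟨f, hf, -, hmap⟩ := exists_crit_none hρ hi
  obtain ⟨l, hl, -⟩ :=
    h f hf fun k hk => hmap k (mem_freeP.1 (hS hk)).1 fun e => hiS (e ▸ hk)
  simp at hl

/-- **Medium-complexity clause** (relative to a partial matching `ρ` with `u ≥ 3` free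
pigeons): every resolution refutation of `PHP^{n+1}_n` contains a clause `C` implied by a set
`S` of free pigeon clauses with `u/3 < |S| ≤ 2u/3` which is minimal (no `S ∖ {i}` implies `C`):
initial clauses need `≤ 1 ≤ u/3` pigeon clauses, the empty clause needs all `u`, and the
measure is subadditive along the refutation, so the first line needing `> u/3` needs `≤ 2u/3`.
[Jukna 2011, proof of Claim 4.15 (and Exercise 4.14); Beame–Pitassi 1996, §3]
[cite: Jukna2011, Claim 4.15 (proof)] -/
theorem exists_medium_clause (hn : 0 < n) {ρ : Finset (ℕ × ℕ)} (hρ : IsPM n ρ)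
    (hu : 3 ≤ (freeP n ρ).card) {π : List (ResLine ℕ)}
    (hπ : IsResRefutation (pigeonholeCNF (n + 1) n) π) :
    ∃ l ∈ π, ∃ S ⊆ freeP n ρ, Imp n ρ S l.clause ∧ (freeP n ρ).card < 3 * S.card ∧
      3 * S.card ≤ 2 * (freeP n ρ).card ∧ ∀ i ∈ S, ¬ Imp n ρ (S.erase i) l.clause := by
  classical
  by_contra hno
  -- every line is "small": implied by at most `u/3` free pigeon clauses
  have hsmall : ∀ k (hk : k < π.length), ∃ S ⊆ freeP n ρ,
      3 * S.card ≤ (freeP n ρ).card ∧ Imp n ρ S (π[k]).clause := by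
    intro k
    induction k using Nat.strong_induction_on with
    | _ k ih =>
      intro hk
      have hvalid := hπ.1 k hk
      unfold IsValidResLine at hvalid
      split at hvalid
      · -- initial clause: at most one pigeon clause
        obtain ⟨S, hS, hS1, hSimp⟩ := exists_imp_initial (ρ := ρ) hn hvalid
        exact ⟨S, hS, by omega, hSimp⟩
      · -- resolution step from earlier lines `i, j < k`
        rename_i i j v _
        obtain ⟨hi, hj, hres⟩ := hvalid
        have hik : i < k := (by simpa [List.length_take] using hi : i < k ∧ i < π.length).1
        have hjk : j < k := (by simpa [List.length_take] using hj : j < k ∧ j < π.length).1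
        rw [List.getElem_take, List.getElem_take] at hres
        obtain ⟨S₁, hS₁, hS₁c, h₁⟩ := ih i hik (hik.trans hk)
        obtain ⟨S₂, hS₂, hS₂c, h₂⟩ := ih j hjk (hjk.trans hk)
        have h₀ : Imp n ρ (S₁ ∪ S₂) (π[k]).clause := h₁.resolvent h₂ hres
        -- a minimum-cardinality implying subset of `S₁ ∪ S₂`
        obtain ⟨S, hSmem, hSmin⟩ := exists_min_image
          ((S₁ ∪ S₂).powerset.filter fun S => Imp n ρ S (π[k]).clause) Finset.card
          ⟨S₁ ∪ S₂, by rw [mem_filter, mem_powerset]; exact ⟨Subset.rfl, h₀⟩⟩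
        rw [mem_filter, mem_powerset] at hSmem
        have hSU : S ⊆ freeP n ρ := hSmem.1.trans (union_subset hS₁ hS₂)
        by_cases hsm : 3 * S.card ≤ (freeP n ρ).card
        · exact ⟨S, hSU, hsm, hSmem.2⟩
        · exfalso
          refine hno ⟨π[k], List.getElem_mem hk, S, hSU, hSmem.2, by omega, ?_, ?_⟩
          · calc 3 * S.card ≤ 3 * (S₁ ∪ S₂).card :=
                  Nat.mul_le_mul_left 3 (card_le_card hSmem.1)
              _ ≤ 3 * (S₁.card + S₂.card) := Nat.mul_le_mul_left 3 (card_union_le _ _)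
              _ ≤ 2 * (freeP n ρ).card := by omega
          · intro i hiS himp
            have hmem : S.erase i ∈
                (S₁ ∪ S₂).powerset.filter fun S => Imp n ρ S (π[k]).clause := by
              rw [mem_filter, mem_powerset]
              exact ⟨(erase_subset i S).trans hSmem.1, himp⟩
            have h1 := hSmin _ hmem
            rw [card_erase_of_mem hiS] at h1
            have hpos : 0 < S.card := card_pos.2 ⟨i, hiS⟩
            omega
      · -- weakening of an earlier line `i < k`
        rename_i i _
        obtain ⟨hi, hsub⟩ := hvalid
        have hik : i < k := (by simpa [List.length_take] using hi : i < k ∧ i < π.length).1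
        rw [List.getElem_take] at hsub
        obtain ⟨S, hS, hSc, h⟩ := ih i hik (hik.trans hk)
        exact ⟨S, hS, hSc, h.weaken hsub⟩
  -- but the empty clause is not small
  obtain ⟨l, hl, hl0⟩ := hπ.2
  obtain ⟨k, hk, rfl⟩ := List.mem_iff_getElem.1 hl
  obtain ⟨S, hS, hSc, h⟩ := hsmall k hk
  rw [hl0] at h
  have := card_le_card (freeP_subset_of_imp_empty hρ hS h)
  omega

/-! ### Beame–Pitassi's monotone variable set and the width lemma -/

/-- The set of *monotone variables* of a clause `C` relative to `ρ` (the variables of Buss's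
positive translation `C⁺`, restricted to free pigeons and free holes): `(i, l)` with `i` a
free pigeon and `l` a free hole such that `x_{il} ∈ C`, or `¬x_{kl} ∈ C` for some free pigeon
`k ≠ i`. [Jukna 2011, proof of Thm. 4.13 (the positive pseudo-proof `C ↦ C⁺`, after Buss
1987); Beame–Pitassi 1996, §3] [cite: Jukna2011, Thm. 4.13 (proof)] -/
def monoVars (n : ℕ) (ρ : Finset (ℕ × ℕ)) (C : Finset (Literal ℕ)) : Finset (ℕ × ℕ) :=
  (freeP n ρ ×ˢ freeH n ρ).filter fun p =>
    (p.1 * n + p.2, true) ∈ C ∨ ∃ k ∈ freeP n ρ, k ≠ p.1 ∧ (k * n + p.2, false) ∈ C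

/-- Membership in `monoVars`. [folklore] -/
theorem mem_monoVars {ρ : Finset (ℕ × ℕ)} {C : Finset (Literal ℕ)} {p : ℕ × ℕ} :
    p ∈ monoVars n ρ C ↔ (p.1 ∈ freeP n ρ ∧ p.2 ∈ freeH n ρ) ∧
      ((p.1 * n + p.2, true) ∈ C ∨ ∃ k ∈ freeP n ρ, k ≠ p.1 ∧ (k * n + p.2, false) ∈ C) := by
  simp only [monoVars, mem_filter, mem_product]

/-- `monoVars ⊆ freeP × freeH`. [folklore] -/
theorem monoVars_subset (ρ : Finset (ℕ × ℕ)) (C : Finset (Literal ℕ)) :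
    monoVars n ρ C ⊆ freeP n ρ ×ˢ freeH n ρ :=
  filter_subset _ _

/-- **Width lemma** (Beame–Pitassi; Jukna's Claim 4.15, relative to a partial matching): if
the free pigeon clauses of `S` imply `C` on critical placements compatible with `ρ` and no
`S ∖ {i}` does, then `C` has at least `|S| · (u - |S|)` monotone variables (`u` = number of
free pigeons): for `i ∈ S` take an `i`-critical `α` placing `S ∖ {i}` and falsifying `C`; for a
free pigeon `k ∉ S` in hole `l`, moving hole `l` from `k` to `i` gives a critical placement
placing all of `S`, hence satisfying `C`, and the two assignments differ only on `x_{il}`,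
`x_{kl}`; so `x_{il} ∈ C` or `¬x_{kl} ∈ C`, i.e. `(i, l)` is a monotone variable of `C`.
[Jukna 2011, Claim 4.15; Beame–Pitassi 1996, §3, Lemma 1 (p. 277)] [cite: Jukna2011, Claim 4.15] -/
theorem card_monoVars_ge (hn : 0 < n) {ρ : Finset (ℕ × ℕ)} {S : Finset ℕ}
    {C : Finset (Literal ℕ)} (hS : S ⊆ freeP n ρ) (himp : Imp n ρ S C)
    (hmin : ∀ i ∈ S, ¬ Imp n ρ (S.erase i) C) :
    S.card * ((freeP n ρ).card - S.card) ≤ (monoVars n ρ C).card := by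
  classical
  -- falsifying critical placements, one for each `i ∈ S`
  have hF : ∀ i, ∃ f : ℕ → Option ℕ, i ∈ S →
      Crit n ρ f ∧ (∀ k ∈ S.erase i, f k ≠ none) ∧ ¬ finsetClauseEval (assign n f) C := by
    intro i
    by_cases hi : i ∈ S
    · have h := hmin i hi
      unfold Imp at h
      push Not at h
      obtain ⟨f, hf, hfS, hfC⟩ := h
      exact ⟨f, fun _ => ⟨hf, hfS, hfC⟩⟩
    · exact ⟨fun _ => none, fun h => (hi h).elim⟩
  choose F hF using hF
  -- `F i` omits exactly pigeon `i`
  have hFi : ∀ i ∈ S, F i i = none := by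
    intro i hi
    obtain ⟨hf, hfS, hfC⟩ := hF i hi
    by_contra hne
    exact hfC (himp _ hf fun k hk =>
      if hki : k = i then hki ▸ hne else hfS k (mem_erase.2 ⟨hki, hk⟩))
  have hFk : ∀ i ∈ S, ∀ k ≤ n, k ≠ i → ∃ l, F i k = some l := by
    intro i hi k hk hki
    obtain ⟨hf, -, -⟩ := hF i hi
    rcases hFk' : F i k with _ | l
    · exact absurd (hf.uniq k i hk (mem_freeP.1 (hS hi)).1 hFk' (hFi i hi)) hki
    · exact ⟨l, rfl⟩
  -- the swap: for `i ∈ S` and a free pigeon `k ∉ S` placed in hole `l` by `F i`,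
  -- `(i, l)` is a monotone variable of `C`
  have key : ∀ i ∈ S, ∀ k ∈ freeP n ρ \ S, ∀ l, F i k = some l → (i, l) ∈ monoVars n ρ C := by
    intro i hi k hk l hkl
    rw [mem_sdiff] at hk
    obtain ⟨hkU, hkS⟩ := hk
    have hki : k ≠ i := fun e => hkS (e ▸ hi)
    obtain ⟨hf, hfS, hfC⟩ := hF i hi
    have hiU := hS hi
    have hin : i ≤ n := (mem_freeP.1 hiU).1
    have hkn : k ≤ n := (mem_freeP.1 hkU).1
    have hln : l < n := hf.lt_of_some k l hkl
    -- `l` is a free hole (it is the hole of the free pigeon `k`)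
    have hlH : l ∈ freeH n ρ := by
      rw [mem_freeH]
      refine ⟨hln, fun p hp hpl => ?_⟩
      have h1 : F i p.1 = some l := hpl ▸ hf.ext p hp
      exact (mem_freeP.1 hkU).2 p hp (hf.inj p.1 k l h1 hkl)
    -- the swapped placement: `i ↦ l`, `k` unplaced
    let f' : ℕ → Option ℕ := fun x => if x = i then some l else if x = k then none else F i x
    have hf'i : f' i = some l := by simp [f']
    have hf'k : f' k = none := by simp [f', hki]
    have hf'o : ∀ x, x ≠ i → x ≠ k → f' x = F i x := fun x hxi hxk => by simp [f', hxi, hxk]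
    have hsome : ∀ z j, f' z = some j → (z = i ∧ j = l) ∨ (z ≠ i ∧ z ≠ k ∧ F i z = some j) := by
      intro z j hz
      by_cases hzi : z = i
      · subst hzi; rw [hf'i] at hz; cases hz; exact Or.inl ⟨rfl, rfl⟩
      by_cases hzk : z = k
      · subst hzk; rw [hf'k] at hz; cases hz
      rw [hf'o z hzi hzk] at hz; exact Or.inr ⟨hzi, hzk, hz⟩
    have hnone : ∀ z, z ≤ n → f' z = none → z = k := by
      intro z hz hzn
      by_cases hzi : z = i
      · subst hzi; rw [hf'i] at hzn; cases hzn
      by_cases hzk : z = k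
      · exact hzk
      rw [hf'o z hzi hzk] at hzn
      exact absurd (hf.uniq z i hz hin hzn (hFi i hi)) hzi
    have hcrit : Crit n ρ f' := by
      refine ⟨?_, ?_, ?_, ?_, fun x y hx hy hxn hyn => by rw [hnone x hx hxn, hnone y hy hyn],
        ⟨k, hkn, hf'k⟩⟩
      · intro p hp
        rw [hf'o p.1 ((mem_freeP.1 hiU).2 p hp) ((mem_freeP.1 hkU).2 p hp)]
        exact hf.ext p hp
      · intro x j hxj
        rcases hsome x j hxj with ⟨rfl, -⟩ | ⟨-, -, hx⟩
        · exact hin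
        · exact hf.le_of_some x j hx
      · intro x j hxj
        rcases hsome x j hxj with ⟨-, rfl⟩ | ⟨-, -, hx⟩
        · exact hln
        · exact hf.lt_of_some x j hx
      · intro x y j hxj hyj
        rcases hsome x j hxj with ⟨hxi, hjl⟩ | ⟨hxi, hxk, hx⟩ <;>
          rcases hsome y j hyj with ⟨hyi, hjl'⟩ | ⟨hyi, hyk, hy⟩
        · rw [hxi, hyi]
        · rw [hjl] at hy; exact absurd (hf.inj y k l hy hkl) hyk
        · rw [hjl'] at hx; exact absurd (hf.inj x k l hx hkl) hxk
        · exact hf.inj x y j hx hy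
    -- `f'` places all of `S`, hence satisfies `C`; `F i` falsifies `C`
    have hsat : finsetClauseEval (assign n f') C := by
      refine himp f' hcrit fun k' hk' => ?_
      by_cases hk'i : k' = i
      · rw [hk'i, hf'i]; simp
      rw [hf'o k' hk'i fun e => hkS (e ▸ hk')]
      exact hfS k' (mem_erase.2 ⟨hk'i, hk'⟩)
    obtain ⟨⟨v, b⟩, hlit, hval⟩ := (finsetClauseEval_iff _ _).1 hsat
    have hval0 : ¬ assign n (F i) v = b := fun h =>
      hfC ((finsetClauseEval_iff _ _).2 ⟨(v, b), hlit, h⟩)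
    -- the variable `v = x_{x j}` changes value, so `x ∈ {i, k}` and `j = l`
    set x := v / n with hx
    set j := v % n with hj
    have hjn : j < n := Nat.mod_lt _ hn
    have hv : v = x * n + j := by rw [hx, hj, Nat.mul_comm, Nat.div_add_mod]
    simp only [assign] at hval hval0
    rw [← hx, ← hj] at hval hval0
    rw [mem_monoVars]
    refine ⟨⟨hiU, hlH⟩, ?_⟩
    cases b
    · -- negative literal: `F i x = some j`, `f' x ≠ some j`, so `x = k`, `j = l`
      simp only [decide_eq_false_iff_not, not_not] at hval hval0
      by_cases hxi : x = i
      · rw [hxi, hFi i hi] at hval0; exact absurd hval0 (by simp)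
      by_cases hxk : x = k
      · rw [hxk, hkl] at hval0
        have hjl : l = j := Option.some_injective _ hval0
        refine Or.inr ⟨k, hkU, hki, ?_⟩
        show (k * n + l, false) ∈ C
        rw [hv, hxk] at hlit
        rw [hjl]; exact hlit
      · rw [hf'o x hxi hxk] at hval; exact absurd hval0 hval
    · -- positive literal: `f' x = some j`, `F i x ≠ some j`, so `x = i`, `j = l`
      simp only [decide_eq_true_eq] at hval hval0
      by_cases hxi : x = i
      · rw [hxi, hf'i] at hval
        have hjl : l = j := Option.some_injective _ hval
        refine Or.inl ?_
        show (i * n + l, true) ∈ C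
        rw [hv, hxi] at hlit
        rw [hjl]; exact hlit
      by_cases hxk : x = k
      · rw [hxk, hf'k] at hval; exact absurd hval (by simp)
      · rw [hf'o x hxi hxk] at hval; exact absurd hval hval0
  -- counting: `(i, k) ↦ (i, hole of k under F i)` is injective on `S × (freeP \ S)`
  let g : ℕ × ℕ → ℕ × ℕ := fun q => (q.1, (F q.1 q.2).getD 0)
  have hget : ∀ q ∈ S ×ˢ (freeP n ρ \ S), ∃ l, F q.1 q.2 = some l ∧ g q = (q.1, l) := by
    intro q hq
    rw [mem_product] at hq
    have hq2 := mem_sdiff.1 hq.2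
    obtain ⟨l, hl⟩ := hFk q.1 hq.1 q.2 (mem_freeP.1 hq2.1).1 fun e => hq2.2 (e ▸ hq.1)
    exact ⟨l, hl, by simp [g, hl]⟩
  have hmaps : Set.MapsTo g ↑(S ×ˢ (freeP n ρ \ S)) ↑(monoVars n ρ C) := by
    intro q hq
    rw [mem_coe] at hq
    obtain ⟨l, hl, hgl⟩ := hget q hq
    rw [mem_coe, hgl]
    exact key q.1 (mem_product.1 hq).1 q.2 (mem_product.1 hq).2 l hl
  have hinj : Set.InjOn g ↑(S ×ˢ (freeP n ρ \ S)) := by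
    intro q hq q' hq' hqq'
    rw [mem_coe] at hq hq'
    obtain ⟨l, hl, hgl⟩ := hget q hq
    obtain ⟨l', hl', hgl'⟩ := hget q' hq'
    rw [hgl, hgl', Prod.mk.injEq] at hqq'
    obtain ⟨h1, rfl⟩ := hqq'
    obtain ⟨hf, -, -⟩ := hF q.1 (mem_product.1 hq).1
    have h2 : q.2 = q'.2 := hf.inj q.2 q'.2 l hl (by rw [h1]; exact hl')
    exact Prod.ext h1 h2
  calc S.card * ((freeP n ρ).card - S.card)
      = (S ×ˢ (freeP n ρ \ S)).card := by rw [card_product, card_sdiff_of_subset hS]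
    _ ≤ (monoVars n ρ C).card := card_le_card_of_injOn g hmaps hinj

/-! ### The greedy partial matching (Beame–Pitassi's averaging step, done semantically) -/

open Classical in
/-- The clauses of `Cl` that are *alive* relative to `ρ` (falsified by some critical placement
compatible with `ρ`) and *long* (at least `T` monotone variables relative to `ρ`) — the long
clauses of the restricted positive pseudo-proof in Beame–Pitassi's iteration.
[Jukna 2011, proof of Thm. 4.13 ("long clauses")] [cite: Jukna2011, Thm. 4.13 (proof)] -/
noncomputable def bad (n : ℕ) (ρ : Finset (ℕ × ℕ)) (T : ℕ) (Cl : Finset (Finset (Literal ℕ))) :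
    Finset (Finset (Literal ℕ)) :=
  Cl.filter fun C => ¬ Imp n ρ ∅ C ∧ T ≤ (monoVars n ρ C).card

/-- Membership in `bad`. [folklore] -/
theorem mem_bad {ρ : Finset (ℕ × ℕ)} {T : ℕ} {Cl : Finset (Finset (Literal ℕ))}
    {C : Finset (Literal ℕ)} :
    C ∈ bad n ρ T Cl ↔ C ∈ Cl ∧ ¬ Imp n ρ ∅ C ∧ T ≤ (monoVars n ρ C).card := by
  simp only [bad, mem_filter]

/-- `bad ⊆ Cl`. [folklore] -/
theorem bad_subset (ρ : Finset (ℕ × ℕ)) (T : ℕ) (Cl : Finset (Finset (Literal ℕ))) :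
    bad n ρ T Cl ⊆ Cl := fun _ hC => (mem_bad.1 hC).1

/-- Critical placements compatible with a larger matching are compatible with a smaller one.
[folklore] -/
theorem Crit.anti {ρ ρ' : Finset (ℕ × ℕ)} (h : ρ ⊆ ρ') {f : ℕ → Option ℕ} (hf : Crit n ρ' f) :
    Crit n ρ f :=
  ⟨fun p hp => hf.ext p (h hp), hf.le_of_some, hf.lt_of_some, hf.inj, hf.uniq, hf.exists_none⟩

/-- `freeP` is antitone in `ρ`. [folklore] -/
theorem freeP_anti {ρ ρ' : Finset (ℕ × ℕ)} (h : ρ ⊆ ρ') : freeP n ρ' ⊆ freeP n ρ :=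
  sdiff_subset_sdiff Subset.rfl (image_subset_image h)

/-- `freeH` is antitone in `ρ`. [folklore] -/
theorem freeH_anti {ρ ρ' : Finset (ℕ × ℕ)} (h : ρ ⊆ ρ') : freeH n ρ' ⊆ freeH n ρ :=
  sdiff_subset_sdiff Subset.rfl (image_subset_image h)

/-- `Imp` is monotone in `ρ`. [folklore] -/
theorem Imp.of_subset {ρ ρ' : Finset (ℕ × ℕ)} (h : ρ ⊆ ρ') {S : Finset ℕ}
    {C : Finset (Literal ℕ)} (hC : Imp n ρ S C) : Imp n ρ' S C :=
  fun f hf hS => hC f (hf.anti h) hS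

/-- `monoVars` is antitone in `ρ`. [folklore] -/
theorem monoVars_anti {ρ ρ' : Finset (ℕ × ℕ)} (h : ρ ⊆ ρ') (C : Finset (Literal ℕ)) :
    monoVars n ρ' C ⊆ monoVars n ρ C := by
  intro p hp
  rw [mem_monoVars] at hp ⊢
  exact ⟨⟨freeP_anti h hp.1.1, freeH_anti h hp.1.2⟩,
    hp.2.imp id fun ⟨k, hk, hki, hkC⟩ => ⟨k, freeP_anti h hk, hki, hkC⟩⟩

/-- `bad` is antitone in `ρ`. [folklore] -/
theorem bad_anti {ρ ρ' : Finset (ℕ × ℕ)} (h : ρ ⊆ ρ') (T : ℕ) (Cl : Finset (Finset (Literal ℕ))) :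
    bad n ρ' T Cl ⊆ bad n ρ T Cl := by
  intro C hC
  rw [mem_bad] at hC ⊢
  exact ⟨hC.1, fun h0 => hC.2.1 (h0.of_subset h),
    hC.2.2.trans (card_le_card (monoVars_anti h C))⟩

/-- The elimination step: if `(i, l)` is a monotone variable of `C` relative to `ρ`, then
every critical placement compatible with `ρ ∪ {(i, l)}` satisfies `C` ("all the clauses
containing `x_{ij}` will disappear from the proof"). [Jukna 2011, proof of Thm. 4.13]
[cite: Jukna2011, Thm. 4.13 (proof)] -/
theorem imp_empty_insert (hn : 0 < n) {ρ : Finset (ℕ × ℕ)} {p : ℕ × ℕ} {C : Finset (Literal ℕ)}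
    (hp : p ∈ monoVars n ρ C) : Imp n (insert p ρ) ∅ C := by
  intro f hf _
  have hfp : f p.1 = some p.2 := hf.ext p (mem_insert_self p ρ)
  rw [mem_monoVars] at hp
  obtain ⟨⟨-, hpH⟩, h | ⟨k, -, hkp, hkC⟩⟩ := hp
  · rw [finsetClauseEval_iff]
    refine ⟨_, h, ?_⟩
    simp only [assign_var hn f p.1 (mem_freeH.1 hpH).1, hfp, decide_true]
  · rw [finsetClauseEval_iff]
    refine ⟨_, hkC, ?_⟩
    have : f k ≠ some p.2 := fun hk => hkp (hf.inj k p.1 p.2 hk hfp)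
    simp only [assign_var hn f k (mem_freeH.1 hpH).1, this, decide_false]

/-- Extending a partial matching by a free pigeon and a free hole. [folklore] -/
theorem IsPM.insert {ρ : Finset (ℕ × ℕ)} (hρ : IsPM n ρ) {p : ℕ × ℕ} (hp1 : p.1 ∈ freeP n ρ)
    (hp2 : p.2 ∈ freeH n ρ) : IsPM n (insert p ρ) := by
  obtain ⟨hp1n, hp1ρ⟩ := mem_freeP.1 hp1
  obtain ⟨hp2n, hp2ρ⟩ := mem_freeH.1 hp2
  refine ⟨?_, ?_, ?_, ?_⟩
  · intro q hq
    rcases mem_insert.1 hq with rfl | hq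
    · exact hp1n
    · exact hρ.fst_le q hq
  · intro q hq
    rcases mem_insert.1 hq with rfl | hq
    · exact hp2n
    · exact hρ.snd_lt q hq
  · intro q hq q' hq' he
    rcases mem_insert.1 hq with rfl | hqρ <;> rcases mem_insert.1 hq' with rfl | hq'ρ
    · rfl
    · exact absurd he.symm (hp1ρ q' hq'ρ)
    · exact absurd he (hp1ρ q hqρ)
    · exact hρ.inj_fst q hqρ q' hq'ρ he
  · intro q hq q' hq' he
    rcases mem_insert.1 hq with rfl | hqρ <;> rcases mem_insert.1 hq' with rfl | hq'ρ
    · rfl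
    · exact absurd he.symm (hp2ρ q' hq'ρ)
    · exact absurd he (hp2ρ q hqρ)
    · exact hρ.inj_snd q hqρ q' hq'ρ he

/-- **Greedy step** (Beame–Pitassi's averaging): while fewer than `n` pigeons are matched,
some free (pigeon, hole) pair is a monotone variable of at least a `T / ((n+1) n)` fraction of
the long alive clauses (double counting over the `≤ (n+1) n` free pairs), and matching it
kills them. [Jukna 2011, proof of Thm. 4.13 ("by the pigeonhole principle a variable
`x_{ij}` occurs in at least `ℓ/8` of the long clauses")] [cite: Jukna2011, Thm. 4.13 (proof)] -/
theorem greedy_step (hn : 0 < n) {ρ : Finset (ℕ × ℕ)} (hρ : IsPM n ρ) (hρn : ρ.card < n)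
    (T : ℕ) (Cl : Finset (Finset (Literal ℕ))) :
    ∃ p ∉ ρ, IsPM n (insert p ρ) ∧
      (n + 1) * n * (bad n (insert p ρ) T Cl).card + T * (bad n ρ T Cl).card ≤
        (n + 1) * n * (bad n ρ T Cl).card := by
  classical
  set B := bad n ρ T Cl with hB
  set X := freeP n ρ ×ˢ freeH n ρ with hX
  have hXne : X.Nonempty := by
    rw [hX, nonempty_product, ← card_pos, ← card_pos, card_freeP hρ, card_freeH hρ]
    omega
  -- `g p` = number of long alive clauses having `p` as a monotone variable
  set g : ℕ × ℕ → ℕ := fun p => (B.filter fun C => p ∈ monoVars n ρ C).card with hg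
  -- double counting
  have hsum : ∑ p ∈ X, g p = ∑ C ∈ B, (monoVars n ρ C).card := by
    have h := sum_card_bipartiteAbove_eq_sum_card_bipartiteBelow
      (fun p C => p ∈ monoVars n ρ C) (s := X) (t := B)
    simp only [bipartiteAbove, bipartiteBelow] at h
    rw [hg, h]
    refine sum_congr rfl fun C _ => ?_
    rw [filter_mem_eq_inter, inter_eq_right.2 (monoVars_subset ρ C)]
  have hTB : T * B.card ≤ ∑ p ∈ X, g p := by
    rw [hsum, mul_comm]
    have h := card_nsmul_le_sum B (fun C => (monoVars n ρ C).card) T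
      fun C hC => (mem_bad.1 hC).2.2
    simpa using h
  -- averaging over the free pairs
  obtain ⟨p, hpX, hp⟩ := exists_le_of_sum_le hXne (f := fun _ => ∑ q ∈ X, g q)
    (g := fun p => X.card * g p) (by rw [sum_const, smul_eq_mul, mul_sum])
  have hXcard : X.card ≤ (n + 1) * n := by
    rw [hX, card_product, card_freeP hρ, card_freeH hρ]
    exact Nat.mul_le_mul (Nat.sub_le _ _) (Nat.sub_le _ _)
  have hp' : T * B.card ≤ (n + 1) * n * g p :=
    hTB.trans (hp.trans (Nat.mul_le_mul_right _ hXcard))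
  rw [hX, mem_product] at hpX
  refine ⟨p, fun hpρ => (mem_freeP.1 hpX.1).2 p hpρ rfl, hρ.insert hpX.1 hpX.2, ?_⟩
  -- the clauses hit by `p` are no longer alive
  have hsub : bad n (insert p ρ) T Cl ⊆ B \ B.filter fun C => p ∈ monoVars n ρ C := by
    intro C hC
    rw [mem_sdiff, mem_filter]
    exact ⟨bad_anti (subset_insert p ρ) T Cl hC,
      fun h => (mem_bad.1 hC).2.1 (imp_empty_insert hn h.2)⟩
  have hcard : (bad n (insert p ρ) T Cl).card + g p ≤ B.card := by
    have h1 := card_le_card hsub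
    rw [card_sdiff_of_subset (filter_subset _ _)] at h1
    have h2 : (B.filter fun C => p ∈ monoVars n ρ C).card ≤ B.card :=
      card_le_card (filter_subset _ _)
    have hgp : g p = (B.filter fun C => p ∈ monoVars n ρ C).card := rfl
    omega
  calc (n + 1) * n * (bad n (insert p ρ) T Cl).card + T * B.card
      ≤ (n + 1) * n * (bad n (insert p ρ) T Cl).card + (n + 1) * n * g p :=
        Nat.add_le_add_left hp' _
    _ = (n + 1) * n * ((bad n (insert p ρ) T Cl).card + g p) := by ring
    _ ≤ (n + 1) * n * B.card := Nat.mul_le_mul_left _ hcard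

/-- **Greedy matching**: for every `t ≤ n` there is a partial matching of `t` pigeons whose
long alive clauses number at most `(1 - T/((n+1)n))^t · |Cl|` (iterate `greedy_step`).
[Jukna 2011, proof of Thm. 4.13 ("applying this argument iteratively `d` times")]
[cite: Jukna2011, Thm. 4.13 (proof)] -/
theorem greedy (hn : 0 < n) (T : ℕ) (Cl : Finset (Finset (Literal ℕ))) :
    ∀ t ≤ n, ∃ ρ, IsPM n ρ ∧ ρ.card = t ∧
      ((n + 1) * n) ^ t * (bad n ρ T Cl).card ≤ ((n + 1) * n - T) ^ t * Cl.card := by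
  intro t
  induction t with
  | zero =>
    intro _
    refine ⟨∅, ⟨by simp, by simp, by simp, by simp⟩, rfl, ?_⟩
    simpa using card_le_card (bad_subset (n := n) ∅ T Cl)
  | succ t ih =>
    intro ht
    obtain ⟨ρ, hρ, hcard, hle⟩ := ih (Nat.le_of_succ_le ht)
    obtain ⟨p, hpρ, hρ', hstep⟩ := greedy_step hn hρ (by omega) T Cl
    refine ⟨insert p ρ, hρ', by rw [card_insert_of_notMem hpρ, hcard], ?_⟩
    have h1 : (n + 1) * n * (bad n (insert p ρ) T Cl).card ≤
        ((n + 1) * n - T) * (bad n ρ T Cl).card := by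
      rw [Nat.sub_mul]
      exact Nat.le_sub_of_add_le hstep
    calc ((n + 1) * n) ^ (t + 1) * (bad n (insert p ρ) T Cl).card
        = ((n + 1) * n) ^ t * ((n + 1) * n * (bad n (insert p ρ) T Cl).card) := by ring
      _ ≤ ((n + 1) * n) ^ t * (((n + 1) * n - T) * (bad n ρ T Cl).card) :=
          Nat.mul_le_mul_left _ h1
      _ = ((n + 1) * n - T) * (((n + 1) * n) ^ t * (bad n ρ T Cl).card) := by ring
      _ ≤ ((n + 1) * n - T) * (((n + 1) * n - T) ^ t * Cl.card) := Nat.mul_le_mul_left _ hle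
      _ = ((n + 1) * n - T) ^ (t + 1) * Cl.card := by ring

/-! ### Assembly of the counting argument -/

/-- For `n ≥ 1` a refutation of `PHP^{n+1}_n` has at least two lines (its clauses are
non-empty, so the empty clause is derived from an earlier line). [folklore] -/
theorem two_le_length (hn : 0 < n) {π : List (ResLine ℕ)}
    (hπ : IsResRefutation (pigeonholeCNF (n + 1) n) π) : 2 ≤ π.length := by
  obtain ⟨l, hl, hl0⟩ := hπ.2
  obtain ⟨k, hk, rfl⟩ := List.mem_iff_getElem.1 hl
  have hvalid := hπ.1 k hk
  unfold IsValidResLine at hvalid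
  split at hvalid
  · -- an initial clause of `PHP^{n+1}_n` is non-empty
    exfalso
    unfold CNF.clauseFinsets at hvalid
    obtain ⟨D, hD, hDk⟩ := List.mem_map.1 hvalid
    rw [hl0, List.toFinset_eq_empty_iff] at hDk
    subst hDk
    simp only [pigeonholeCNF, List.mem_append, List.mem_map, List.mem_flatMap,
      List.mem_range] at hD
    rcases hD with ⟨i, -, hi⟩ | ⟨j, -, i', -, i, -, hi⟩
    · have h := congrArg List.length hi
      simp at h
      omega
    · simp at hi
  · rename_i i j v _
    obtain ⟨hi, -, -⟩ := hvalid
    have : i < k := (by simpa [List.length_take] using hi : i < k ∧ i < π.length).1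
    omega
  · rename_i i _
    obtain ⟨hi, -⟩ := hvalid
    have : i < k := (by simpa [List.length_take] using hi : i < k ∧ i < π.length).1
    omega

/-- **The counting argument** (Beame–Pitassi): for `n ≥ 13`, every resolution refutation `π`
of `PHP^{n+1}_n` satisfies `(9/8)^{⌊n/5⌋} ≤ |π|`. With `d = ⌊n/5⌋` matched pigeons,
threshold `T = ⌊n²/8⌋` and `M = (n+1) n` free pairs at most, the greedy matching leaves at
most `(1 - T/M)^d |π| ≤ (8/9)^d |π|` long alive clauses, but the medium clause of the width
lemma is alive and has `≥ 2u²/9 ≥ T` monotone variables (`u = n + 1 - d` free pigeons), so at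
least one long alive clause remains. [Jukna 2011, Thm. 4.13 (proof); Beame–Pitassi 1996,
§3, Thm. 2 (proof)] [cite: Jukna2011, Thm. 4.13 (proof)] -/
theorem main_counting (hn : 13 ≤ n) {π : List (ResLine ℕ)}
    (hπ : IsResRefutation (pigeonholeCNF (n + 1) n) π) :
    9 ^ (n / 5) ≤ 8 ^ (n / 5) * π.length := by
  classical
  have hn0 : 0 < n := by omega
  set d := n / 5 with hd
  set T := n * n / 8 with hT
  set M := (n + 1) * n with hM
  set Cl : Finset (Finset (Literal ℕ)) := (π.map ResLine.clause).toFinset with hCl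
  have hM' : M = n * n + n := by rw [hM]; ring
  have hT8 : 8 * T ≤ n * n := Nat.mul_div_le (n * n) 8
  have hT8' : n * n < 8 * T + 8 := by
    have := Nat.lt_mul_div_succ (n * n) (show 0 < 8 by norm_num)
    omega
  obtain ⟨ρ, hρ, hρcard, hle⟩ := greedy hn0 T Cl d (by omega)
  have hu : (freeP n ρ).card = n + 1 - d := by rw [card_freeP hρ, hρcard]
  obtain ⟨l, hl, S, hS, himp, h1, h2, hmin⟩ :=
    exists_medium_clause hn0 hρ (by rw [hu]; omega) hπ
  have hwidth := card_monoVars_ge hn0 hS himp hmin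
  -- the medium clause is long and alive
  have hbad : l.clause ∈ bad n ρ T Cl := by
    rw [mem_bad]
    refine ⟨?_, fun h0 => ?_, le_trans ?_ hwidth⟩
    · rw [hCl, List.mem_toFinset]
      exact List.mem_map.2 ⟨l, hl, rfl⟩
    · have hSne : S.Nonempty := by rw [← card_pos]; omega
      obtain ⟨i, hi⟩ := hSne
      exact hmin i hi (h0.mono (empty_subset _))
    · -- `T ≤ |S| (u - |S|)` from `u < 3|S| ≤ 2u`, `u = n + 1 - ⌊n/5⌋`, `T = ⌊n²/8⌋`
      obtain ⟨w, hw⟩ : ∃ w, (freeP n ρ).card = S.card + w := ⟨_, (Nat.add_sub_cancel' (by omega)).symm⟩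
      rw [hw, Nat.add_sub_cancel_left]
      rw [hw] at h1 h2 hu
      have h3 : w < 2 * S.card := by omega
      have h4 : S.card ≤ 2 * w := by omega
      have h5 : 4 * n + 5 ≤ 5 * (S.card + w) := by omega
      have key : 2 * ((S.card + w) * (S.card + w)) ≤ 9 * (S.card * w) := by nlinarith
      have h7 : (4 * n + 5) * (4 * n + 5) ≤ (5 * (S.card + w)) * (5 * (S.card + w)) :=
        Nat.mul_self_le_mul_self h5
      nlinarith
  have hB : 0 < (bad n ρ T Cl).card := card_pos.2 ⟨_, hbad⟩
  have hCl_le : Cl.card ≤ π.length := by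
    rw [hCl]
    exact (List.toFinset_card_le _).trans (by rw [List.length_map])
  have h7 : M ^ d ≤ (M - T) ^ d * π.length :=
    calc M ^ d ≤ M ^ d * (bad n ρ T Cl).card := Nat.le_mul_of_pos_right _ hB
      _ ≤ (M - T) ^ d * Cl.card := hle
      _ ≤ (M - T) ^ d * π.length := Nat.mul_le_mul_left _ hCl_le
  -- `M ≤ 9 T` for `n ≥ 13`, so `9 (M - T) ≤ 8 M`
  have h8 : 9 * (M - T) ≤ 8 * M := by
    have h13 : 13 * n ≤ n * n := Nat.mul_le_mul_right n hn
    omega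
  have hMT : 0 < M - T := by omega
  have h9 : 9 ^ d * (M - T) ^ d ≤ 8 ^ d * π.length * (M - T) ^ d :=
    calc 9 ^ d * (M - T) ^ d = (9 * (M - T)) ^ d := by rw [mul_pow]
      _ ≤ (8 * M) ^ d := Nat.pow_le_pow_left h8 d
      _ = 8 ^ d * M ^ d := mul_pow 8 M d
      _ ≤ 8 ^ d * ((M - T) ^ d * π.length) := Nat.mul_le_mul_left _ h7
      _ = 8 ^ d * π.length * (M - T) ^ d := by ring
  exact Nat.le_of_mul_le_mul_right h9 (Nat.pow_pos hMT)

end HakenPHP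

open HakenPHP in
/-- **Haken's theorem** (pnp.S31; discharge of the named fact `haken_pigeonhole`): there is
`c > 1` (here `c = 101/100`) such that every resolution refutation of the pigeonhole CNF
`PHP^{n+1}_n` has at least `c ^ n` lines, for every `n`. Haken's original proof ("bottleneck
counting", Haken 1985, §2) is replaced by the Beame–Pitassi (1996) argument as presented by
Jukna (2011, Thm. 4.13 with Claims 4.14–4.15): critical truth assignments, Buss's positive
translation, a greedy restriction killing the long clauses, and the width lemma for clauses of
medium semantic complexity. The restriction is carried out *semantically* (all notions are
taken relative to a partial matching `ρ`, `HakenPHP.Crit`, `HakenPHP.Imp`, `HakenPHP.monoVars`)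
instead of rewriting the refutation, which gives `(9/8)^{⌊n/5⌋} ≤ |π|` for `n ≥ 13`
(`HakenPHP.main_counting`); small `n` are covered by `|π| ≥ 2` (`n ≥ 1`) and `|π| ≥ 1`.
In print: Jukna, Thm. 4.13: "For a sufficiently large `n`, any Resolution proof of `PHP^n_{n-1}`
requires length `2^{Ω(n)}`" (there with `t ≥ 2^{n/32}`); Haken 1985, main theorem (§2.1).
[cite: Haken1985, §2.1 Theorem (p. 301)] [cite: BeamePitassi1996, §3 Thm. 2 and Lemma 1 (pp. 276–277)]
[cite: Jukna2011, Thm. 4.13 with Claims 4.14–4.15 (§4.8.2)] -/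
theorem haken_pigeonhole_holds : haken_pigeonhole := by
  refine ⟨101 / 100, by norm_num, fun n π hπ => ?_⟩
  have hlen1 : 1 ≤ π.length := by
    obtain ⟨l, hl, -⟩ := hπ.2
    exact List.length_pos_of_mem hl
  by_cases hn : 13 ≤ n
  · have h := main_counting hn hπ
    have hd : n ≤ 9 * (n / 5) := by omega
    have hR : (9 : ℝ) ^ (n / 5) ≤ 8 ^ (n / 5) * π.length := by exact_mod_cast h
    calc ((101 : ℝ) / 100) ^ n ≤ (101 / 100) ^ (9 * (n / 5)) :=
          pow_le_pow_right₀ (by norm_num) hd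
      _ = ((101 / 100) ^ 9) ^ (n / 5) := pow_mul _ _ _
      _ ≤ (9 / 8) ^ (n / 5) := pow_le_pow_left₀ (by norm_num) (by norm_num) _
      _ = 9 ^ (n / 5) / 8 ^ (n / 5) := div_pow 9 8 (n / 5)
      _ ≤ π.length := by
          rw [div_le_iff₀ (by positivity), mul_comm]
          exact hR
  · push Not at hn
    rcases Nat.eq_zero_or_pos n with rfl | hn0
    · simpa using hlen1
    · have hlen2 : 2 ≤ π.length := two_le_length hn0 hπ
      calc ((101 : ℝ) / 100) ^ n ≤ (101 / 100) ^ 12 :=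
            pow_le_pow_right₀ (by norm_num) (by omega)
        _ ≤ 2 := by norm_num
        _ ≤ π.length := by exact_mod_cast hlen2

end Literature.Computability.Complexity
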